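import Mathlib.Analysis.InnerProductSpace.Calculus
import Mathlib.Analysis.Calculus.Deriv.Inv
import Mathlib.Analysis.Calculus.Deriv.Mul
import Mathlib.Analysis.Calculus.Deriv.Add
import Mathlib.Analysis.Calculus.FDeriv.Prod
import Mathlib.Analysis.Calculus.ContDiff.Basic
import Mathlib.LinearAlgebra.FiniteDimensional.Basic
import Mathlib.Topology.Algebra.Module.FiniteDimension
import HarnessLib

/-!
# Radial zones of the tube stage, II: rounding the cone over the link

Topic `Literature/Topology/FourManifolds`; Euclidean analysis in `E × F`, companion of
`TubeRadial.lean` and `TubeConeify.lean` (independent of both; codimension `≥ 2` steps of the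
smoothing of PD homeomorphisms: Munkres, Ann. of Math. 72 (1960), §§4–5; Campbell–D'Onofrio–Vítek,
J. Geom. Anal. (2026), Lemma 3.4 Step 2: "an injective convex combination of `ĝ` and its
projection onto a sphere").  With `t = ‖y‖`, `ŷ = y/t`, and the **link field**
`V (x, y) = r₁⁻¹ • N (x, r₁ ŷ)` of `N : E × F → F` at radius `r₁` (homogeneous of degree zero in
`y`), the **rounding map** is

  `roundMap N r₁ ρ η (x, y) = (t ((1 − η t) ρ / ‖V‖ + η t)) • V (x, y)`:

where `η = 1` it is the exact cone `t • V` (the inner end of cone-ification), where `η = 0` it is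
the round cone `(ρ t) • V/‖V‖` (the outer end of the untwist zones), and in between the radial
profile interpolates while the link DIRECTION `V/‖V‖` is kept.  We prove the identities, the
smoothness off the zero section, the fibre derivative along `w`
(`fderiv_roundMap_apply_inr`: `(a c₀ + t c₁) • V + c₀ • D_yN(q₁)(w − a ŷ)`, `a = ⟪ŷ, w⟫`), and the
**nondegeneracy** (`injective_fderiv_roundStageMap`): if the profile is monotone (`η' ≥ 0`),
`0 < ρ ≤ ‖V‖`, and the link of `N` at radius `r₁` is radially transversal (injective fibre
derivative and `D_yN v = N ⟹ ⟪v, ŷ⟫ > 0`, as in `TubeLink.lean`), then the stage derivative is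
injective: the angular part `w − a ŷ` of a kernel vector has `D_yN` in the line of `N`, hence
vanishes, and then `a (c₀ + t η'(1 − ρ/‖V‖)) = 0` with a positive bracket.  No slowness of `η` is
needed (it only controls the exported Euler defect).  Definitions are explicit functions; no named
facts are introduced.

## References

* J. R. Munkres, *Obstructions to the smoothing of piecewise-differentiable homeomorphisms*, Ann.
  of Math. (2) 72 (1960), 521–554, §§4–5. [Munkres1960]
* D. Campbell, L. D'Onofrio, T. Vítek, *Diffeomorphic approximation of piecewise affine
  homeomorphisms*, J. Geom. Anal. 36 (2026), Lemma 3.4 (Step 2). [CampbellDonofrioVitek2026]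
-/

noncomputable section

open Set Function Metric Filter
open scoped Topology ContDiff RealInnerProductSpace

namespace Literature.Topology.FourManifolds

variable {E : Type*} [NormedAddCommGroup E] [NormedSpace ℝ E]
variable {F : Type*} [NormedAddCommGroup F] [InnerProductSpace ℝ F]

/-- `∞ ≠ 0` in the smoothness exponents (bookkeeping). [folklore] -/
private theorem round_infty_ne_zero : (∞ : WithTop ℕ∞) ≠ 0 := by
  simp

/-! ### §1 Calculus along a line (private copies) -/

section LineCalculus

variable {y w : F}

omit [NormedAddCommGroup E] [NormedSpace ℝ E] in
/-- Derivative of the norm away from `0` (private copy of the tree's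
`Literature.Analysis.Potential.HyperbolicBall.hasFDerivAt_norm_of_ne_zero`). [folklore] -/
private theorem round_hasFDerivAt_norm (hy : y ≠ 0) :
    HasFDerivAt (fun z : F => ‖z‖) (innerSL ℝ (‖y‖⁻¹ • y)) y := by
  have hy2 : ‖y‖ ^ 2 ≠ 0 := by positivity
  have h2 := (hasStrictFDerivAt_norm_sq y).hasFDerivAt.sqrt hy2
  have hfun : (fun z : F => ‖z‖) = fun z => Real.sqrt (‖z‖ ^ 2) := by
    funext z
    rw [Real.sqrt_sq (norm_nonneg z)]
  rw [hfun]
  refine h2.congr_fderiv (ContinuousLinearMap.ext fun v => ?_)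
  rw [Real.sqrt_sq (norm_nonneg y)]
  have hy0 : ‖y‖ ≠ 0 := norm_ne_zero_iff.2 hy
  simp only [innerSL_apply_apply, real_inner_smul_left]
  change (1 / (2 * ‖y‖)) • ((2 : ℕ) • innerSL ℝ y) v = ‖y‖⁻¹ * ⟪y, v⟫
  rw [two_nsmul]
  change (1 / (2 * ‖y‖)) * (⟪y, v⟫ + ⟪y, v⟫) = ‖y‖⁻¹ * ⟪y, v⟫
  field_simp
  ring

omit [NormedAddCommGroup E] [NormedSpace ℝ E] in
/-- The line `τ ↦ y + τ • w` has derivative `w`. [folklore] -/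
private theorem round_hasDerivAt_line (y w : F) (τ₀ : ℝ) :
    HasDerivAt (fun τ : ℝ => y + τ • w) w τ₀ := by
  have h := ((hasDerivAt_id τ₀).smul_const w).const_add y
  rw [one_smul] at h
  exact h

omit [NormedAddCommGroup E] [NormedSpace ℝ E] in
/-- Derivative of `τ ↦ ‖y + τ • w‖` at `0`: `⟪ŷ, w⟫`. [folklore] -/
private theorem round_hasDerivAt_norm_line (hy : y ≠ 0) :
    HasDerivAt (fun τ : ℝ => ‖y + τ • w‖) ⟪‖y‖⁻¹ • y, w⟫ 0 :=
  (round_hasFDerivAt_norm hy).comp_hasDerivAt_of_eq (0 : ℝ) (round_hasDerivAt_line y w 0) (by simp)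

omit [NormedAddCommGroup E] [NormedSpace ℝ E] in
/-- Derivative of the norm of a differentiable curve off `0`: `⟪γ/‖γ‖, γ'⟫`. [folklore] -/
private theorem round_hasDerivAt_norm_comp {γ : ℝ → F} {γ' : F} {τ₀ : ℝ} (hγ : HasDerivAt γ γ' τ₀)
    (h0 : γ τ₀ ≠ 0) :
    HasDerivAt (fun τ : ℝ => ‖γ τ‖) ⟪‖γ τ₀‖⁻¹ • γ τ₀, γ'⟫ τ₀ :=
  (round_hasFDerivAt_norm h0).comp_hasDerivAt_of_eq τ₀ hγ rfl

end LineCalculus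

/-! ### §2 The link field and the rounding map -/

section Round

/-- **The link field** of `N` at radius `r₁`: `linkField N r₁ (x, y) = r₁⁻¹ • N (x, (r₁/‖y‖) • y)`,
homogeneous of degree zero in `y`; `t • linkField` is the exact cone of `TubeConeify.lean`.
[folklore] -/
def linkField (N : E × F → F) (r₁ : ℝ) (p : E × F) : F :=
  r₁⁻¹ • N (p.1, (r₁ / ‖p.2‖) • p.2)

/-- The point of the link sphere where `N` is read: `q₁ = (x, (r₁/‖y‖) • y)`. [folklore] -/
def linkPoint (r₁ : ℝ) (p : E × F) : E × F :=
  (p.1, (r₁ / ‖p.2‖) • p.2)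

/-- **The rounding map** `roundMap N r₁ ρ η (x, y) = (‖y‖ ((1 − η ‖y‖) ρ / ‖V‖ + η ‖y‖)) • V`,
`V = linkField N r₁ (x, y)`: a radial interpolation between the round cone `(ρ‖y‖) • V/‖V‖`
(`η = 0`) and the exact cone `‖y‖ • V` (`η = 1`). Campbell–D'Onofrio–Vítek (2026), Lemma 3.4
Step 2 (`η ĝ + (1 − η) ρ|x| ĝ/|ĝ|` on the exact cone). [cite: CampbellDonofrioVitek2026, Lemma 3.4 (Step 2)] -/
def roundMap (N : E × F → F) (r₁ ρ : ℝ) (η : ℝ → ℝ) (p : E × F) : F :=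
  (‖p.2‖ * ((1 - η ‖p.2‖) * ρ / ‖linkField N r₁ p‖ + η ‖p.2‖)) • linkField N r₁ p

/-- The rounded stage map `p ↦ (p.1, roundMap N r₁ ρ η p)`. [folklore] -/
def roundStageMap (N : E × F → F) (r₁ ρ : ℝ) (η : ℝ → ℝ) (p : E × F) : E × F :=
  (p.1, roundMap N r₁ ρ η p)

variable {N : E × F → F} {r₁ ρ : ℝ} {η : ℝ → ℝ} {p : E × F}

omit [NormedAddCommGroup E] [NormedSpace ℝ E] in
/-- The stage map keeps the parameters. [folklore] -/
@[simp]
theorem roundStageMap_fst (p : E × F) : (roundStageMap N r₁ ρ η p).1 = p.1 := rfl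

omit [NormedAddCommGroup E] [NormedSpace ℝ E] in
/-- The fibre component of the stage map. [folklore] -/
@[simp]
theorem roundStageMap_snd (p : E × F) : (roundStageMap N r₁ ρ η p).2 = roundMap N r₁ ρ η p := rfl

omit [NormedAddCommGroup E] [NormedSpace ℝ E] in
/-- The link point keeps the parameters. [folklore] -/
@[simp]
theorem linkPoint_fst (p : E × F) : (linkPoint r₁ p).1 = p.1 := rfl

omit [NormedAddCommGroup E] [NormedSpace ℝ E] in
/-- The link field in terms of the link point. [folklore] -/
theorem linkField_eq (p : E × F) : linkField N r₁ p = r₁⁻¹ • N (linkPoint r₁ p) := rfl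

omit [NormedAddCommGroup E] [NormedSpace ℝ E] in
/-- The link point lies on the sphere of radius `r₁` (`r₁ ≥ 0`, `y ≠ 0`). [folklore] -/
theorem norm_linkPoint_snd (hp : p.2 ≠ 0) (hr : 0 ≤ r₁) : ‖(linkPoint r₁ p).2‖ = r₁ := by
  rw [linkPoint, norm_smul, Real.norm_of_nonneg (div_nonneg hr (norm_nonneg _)),
    div_mul_cancel₀ _ (norm_ne_zero_iff.2 hp)]

omit [NormedAddCommGroup E] [NormedSpace ℝ E] in
/-- The link point is a positive multiple of `ŷ`: `(linkPoint r₁ p).2 = r₁ • ŷ`. [folklore] -/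
theorem linkPoint_snd_eq (p : E × F) : (linkPoint r₁ p).2 = r₁ • (‖p.2‖⁻¹ • p.2) := by
  rw [linkPoint, smul_smul, div_eq_mul_inv]

omit [NormedAddCommGroup E] [NormedSpace ℝ E] in
/-- **The link field is homogeneous of degree zero in the fibre.** [folklore] -/
theorem linkField_smul (p : E × F) {c : ℝ} (hc : 0 < c) :
    linkField N r₁ (p.1, c • p.2) = linkField N r₁ p := by
  by_cases hp : p.2 = 0
  · simp [linkField, hp]
  · simp only [linkField]
    congr 2
    refine Prod.ext rfl ?_
    simp only
    rw [norm_smul, Real.norm_of_nonneg hc.le, smul_smul]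
    congr 1
    field_simp

omit [NormedAddCommGroup E] [NormedSpace ℝ E] in
/-- **Where `η = 1` the rounding map is the exact cone `‖y‖ • V`.** [folklore] -/
theorem roundMap_of_eta_eq_one (h : η ‖p.2‖ = 1) : roundMap N r₁ ρ η p = ‖p.2‖ • linkField N r₁ p := by
  rw [roundMap, h, sub_self, zero_mul, zero_div, zero_add, mul_one]

omit [NormedAddCommGroup E] [NormedSpace ℝ E] in
/-- **Where `η = 0` the rounding map is the round cone `(ρ ‖y‖) • V/‖V‖`.** [folklore] -/
theorem roundMap_of_eta_eq_zero (h : η ‖p.2‖ = 0) :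
    roundMap N r₁ ρ η p = (ρ * ‖p.2‖) • (‖linkField N r₁ p‖⁻¹ • linkField N r₁ p) := by
  rw [roundMap, h, sub_zero, one_mul, add_zero, smul_smul, div_eq_mul_inv, mul_comm ρ ‖p.2‖, mul_assoc]

omit [NormedAddCommGroup E] [NormedSpace ℝ E] in
/-- On the zero section the rounding map vanishes. [folklore] -/
theorem roundMap_zero (x : E) : roundMap N r₁ ρ η (x, 0) = 0 := by
  simp [roundMap]

omit [NormedAddCommGroup E] [NormedSpace ℝ E] in
/-- The norm of the rounding map is `‖y‖ ((1 − η)ρ + η ‖V‖)` when the profile coefficient is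
nonnegative. [folklore] -/
theorem norm_roundMap (hV : linkField N r₁ p ≠ 0)
    (hc : 0 ≤ (1 - η ‖p.2‖) * ρ / ‖linkField N r₁ p‖ + η ‖p.2‖) :
    ‖roundMap N r₁ ρ η p‖ = ‖p.2‖ * ((1 - η ‖p.2‖) * ρ + η ‖p.2‖ * ‖linkField N r₁ p‖) := by
  have hb : ‖linkField N r₁ p‖ ≠ 0 := norm_ne_zero_iff.2 hV
  rw [roundMap, norm_smul, Real.norm_of_nonneg (mul_nonneg (norm_nonneg _) hc), mul_assoc]
  congr 1
  field_simp

/-- **Smoothness of the link field off the zero section** (`N` smooth at the link point).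
[folklore] -/
theorem contDiffAt_linkField (hp : p.2 ≠ 0) (hN : ContDiffAt ℝ ∞ N (linkPoint r₁ p)) :
    ContDiffAt ℝ ∞ (linkField N r₁) p := by
  have hn : ContDiffAt ℝ ∞ (fun q : E × F => ‖q.2‖) p := (contDiffAt_norm ℝ hp).comp p contDiffAt_snd
  have hpt : ContDiffAt ℝ ∞ (fun q : E × F => ((q.1, (r₁ / ‖q.2‖) • q.2) : E × F)) p :=
    contDiffAt_fst.prodMk ((contDiffAt_const.div hn (norm_ne_zero_iff.2 hp)).smul contDiffAt_snd)
  exact contDiffAt_const.smul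
    (ContDiffAt.comp (g := N) (f := fun q : E × F => ((q.1, (r₁ / ‖q.2‖) • q.2) : E × F)) p hN hpt)

/-- **Smoothness of the rounding map off the zero section**: `N` smooth at the link point,
`V ≠ 0` there, `η` smooth at `‖y‖`. [folklore] -/
theorem contDiffAt_roundMap (hp : p.2 ≠ 0) (hN : ContDiffAt ℝ ∞ N (linkPoint r₁ p))
    (hV : linkField N r₁ p ≠ 0) (hη : ContDiffAt ℝ ∞ η ‖p.2‖) : ContDiffAt ℝ ∞ (roundMap N r₁ ρ η) p := by
  have hn : ContDiffAt ℝ ∞ (fun q : E × F => ‖q.2‖) p := (contDiffAt_norm ℝ hp).comp p contDiffAt_snd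
  have hVs : ContDiffAt ℝ ∞ (linkField N r₁) p := contDiffAt_linkField hp hN
  have hβ : ContDiffAt ℝ ∞ (fun q : E × F => ‖linkField N r₁ q‖) p := hVs.norm ℝ hV
  have hηn : ContDiffAt ℝ ∞ (fun q : E × F => η ‖q.2‖) p := hη.comp p hn
  have hc : ContDiffAt ℝ ∞
      (fun q : E × F => (1 - η ‖q.2‖) * ρ / ‖linkField N r₁ q‖ + η ‖q.2‖) p :=
    (((contDiffAt_const.sub hηn).mul contDiffAt_const).div hβ (norm_ne_zero_iff.2 hV)).add hηn
  exact (hn.mul hc).smul hVs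

/-- Smoothness of the rounded stage map off the zero section. [folklore] -/
theorem contDiffAt_roundStageMap (hp : p.2 ≠ 0) (hN : ContDiffAt ℝ ∞ N (linkPoint r₁ p))
    (hV : linkField N r₁ p ≠ 0) (hη : ContDiffAt ℝ ∞ η ‖p.2‖) :
    ContDiffAt ℝ ∞ (roundStageMap N r₁ ρ η) p :=
  contDiffAt_fst.prodMk (contDiffAt_roundMap hp hN hV hη)

/-- **The fibre derivative of the link field**: with `t = ‖y‖`, `a = ⟪ŷ, w⟫`, `q₁` the link point
and `L = DN(q₁)`, `D(linkField)(x,y) (0, w) = t⁻¹ • L (0, w − a • ŷ)` — the link field only sees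
the angular part of `w`, with the factor `r₁/t` of the central projection to the sphere of radius
`r₁` cancelling the `r₁⁻¹`. [folklore] -/
theorem fderiv_linkField_apply_inr (hp : p.2 ≠ 0) (hr : r₁ ≠ 0) (hN : ContDiffAt ℝ ∞ N (linkPoint r₁ p))
    (w : F) :
    fderiv ℝ (linkField N r₁) p (0, w) =
      ‖p.2‖⁻¹ • fderiv ℝ N (linkPoint r₁ p) (0, w - ⟪‖p.2‖⁻¹ • p.2, w⟫ • (‖p.2‖⁻¹ • p.2)) := by
  obtain ⟨x, y⟩ := p
  simp only at hp hN ⊢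
  set t : ℝ := ‖y‖ with ht
  have ht0 : 0 < t := norm_pos_iff.2 hp
  have htne : t ≠ 0 := ht0.ne'
  set a : ℝ := ⟪‖y‖⁻¹ • y, w⟫ with ha
  set q : E × F := linkPoint r₁ (x, y) with hq
  set L := fderiv ℝ N q with hL
  -- (1) the derivative along the line equals `DV (0, w)`
  have hd : DifferentiableAt ℝ (linkField N r₁) (x, y) :=
    (contDiffAt_linkField (p := (x, y)) hp hN).differentiableAt round_infty_ne_zero
  have hl : HasDerivAt (fun τ : ℝ => y + τ • w) w 0 := round_hasDerivAt_line y w 0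
  have hline : HasDerivAt (fun τ : ℝ => (((x, y + τ • w)) : E × F)) (((0 : E), w) : E × F) 0 :=
    (hasDerivAt_const (0 : ℝ) x).prodMk hl
  have h1 : HasDerivAt (fun τ : ℝ => linkField N r₁ (x, y + τ • w))
      (fderiv ℝ (linkField N r₁) (x, y) (0, w)) 0 :=
    hd.hasFDerivAt.comp_hasDerivAt_of_eq (0 : ℝ) hline (by simp)
  -- (2) the same derivative by the chain rule
  have hnorm : HasDerivAt (fun τ : ℝ => ‖y + τ • w‖) a 0 := round_hasDerivAt_norm_line hp
  have hv0 : ‖y + (0 : ℝ) • w‖ = t := by rw [zero_smul, add_zero]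
  have hcoef : HasDerivAt (fun τ : ℝ => r₁ / ‖y + τ • w‖) (-(r₁ * a) / t ^ 2) 0 := by
    have := (hasDerivAt_const (0 : ℝ) r₁).fun_div hnorm (by rw [hv0]; exact htne)
    rw [hv0, zero_mul, zero_sub] at this
    exact this
  have hpt2 : HasDerivAt (fun τ : ℝ => (r₁ / ‖y + τ • w‖) • (y + τ • w))
      ((-(r₁ * a) / t ^ 2) • y + (r₁ / t) • w) 0 := by
    have := hcoef.fun_smul hl
    rw [hv0, zero_smul, add_zero, add_comm] at this
    exact this
  have hpt : HasDerivAt (fun τ : ℝ => (((x, (r₁ / ‖y + τ • w‖) • (y + τ • w))) : E × F))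
      (((0 : E), (-(r₁ * a) / t ^ 2) • y + (r₁ / t) • w) : E × F) 0 :=
    (hasDerivAt_const (0 : ℝ) x).prodMk hpt2
  have hNd : HasFDerivAt N L q := (hN.differentiableAt round_infty_ne_zero).hasFDerivAt
  have hNc : HasDerivAt (fun τ : ℝ => N (x, (r₁ / ‖y + τ • w‖) • (y + τ • w)))
      (L (0, (-(r₁ * a) / t ^ 2) • y + (r₁ / t) • w)) 0 :=
    hNd.comp_hasDerivAt_of_eq (0 : ℝ) hpt (by rw [zero_smul, add_zero]; rfl)
  have h2 : HasDerivAt (fun τ : ℝ => linkField N r₁ (x, y + τ • w))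
      (r₁⁻¹ • L (0, (-(r₁ * a) / t ^ 2) • y + (r₁ / t) • w)) 0 :=
    hNc.const_smul r₁⁻¹
  rw [h1.unique h2]
  -- (3) simplify: `(0, c • y + d • w) = (r₁/t) • (0, w − a • ŷ)`
  have hvec : (((0 : E), (-(r₁ * a) / t ^ 2) • y + (r₁ / t) • w) : E × F) =
      (r₁ / t) • ((0 : E), w - a • (‖y‖⁻¹ • y)) := by
    ext
    · simp
    · simp only [Prod.smul_snd, smul_sub, smul_smul]
      rw [← ht]
      have e : r₁ / t * a * t⁻¹ = -(-(r₁ * a) / t ^ 2) := by field_simp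
      rw [show r₁ / t * (a * t⁻¹) = r₁ / t * a * t⁻¹ by ring, e, neg_smul, sub_neg_eq_add, add_comm]
  rw [hvec, map_smul, smul_smul, ← ht]
  congr 1
  field_simp

/-- **The fibre derivative of the rounding map.** With `t = ‖y‖ ≠ 0`, `a = ⟪ŷ, w⟫`,
`V = linkField N r₁ p ≠ 0`, `β = ‖V‖`, `q₁` the link point, `L = DN(q₁)`, `u = w − a • ŷ` and
`U = t⁻¹ • L (0, u)` (the fibre derivative of `V` along `w`), one has
`D(roundMap)(x,y) (0, w) = (a c₀ + t c₁) • V + (t c₀) • U` where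
`c₀ = (1 − η t) ρ/β + η t` is the profile coefficient and
`c₁ = η'(t) a (1 − ρ/β) − (1 − η t) ρ ⟪β⁻¹ • V, U⟫ / β²` its derivative along the line.
[folklore] -/
theorem fderiv_roundMap_apply_inr (hp : p.2 ≠ 0) (hN : ContDiffAt ℝ ∞ N (linkPoint r₁ p))
    (hV : linkField N r₁ p ≠ 0) (hη : ContDiffAt ℝ ∞ η ‖p.2‖) (w : F) :
    fderiv ℝ (roundMap N r₁ ρ η) p (0, w) =
      (⟪‖p.2‖⁻¹ • p.2, w⟫ * ((1 - η ‖p.2‖) * ρ / ‖linkField N r₁ p‖ + η ‖p.2‖) +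
          ‖p.2‖ * (deriv η ‖p.2‖ * ⟪‖p.2‖⁻¹ • p.2, w⟫ * (1 - ρ / ‖linkField N r₁ p‖) -
            (1 - η ‖p.2‖) * ρ *
              ⟪‖linkField N r₁ p‖⁻¹ • linkField N r₁ p, fderiv ℝ (linkField N r₁) p (0, w)⟫ /
                ‖linkField N r₁ p‖ ^ 2)) • linkField N r₁ p +
        (‖p.2‖ * ((1 - η ‖p.2‖) * ρ / ‖linkField N r₁ p‖ + η ‖p.2‖)) •
          fderiv ℝ (linkField N r₁) p (0, w) := by
  obtain ⟨x, y⟩ := p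
  simp only at hp hN hV hη ⊢
  set t : ℝ := ‖y‖ with ht
  have ht0 : 0 < t := norm_pos_iff.2 hp
  have htne : t ≠ 0 := ht0.ne'
  set a : ℝ := ⟪‖y‖⁻¹ • y, w⟫ with ha
  set V₀ : F := linkField N r₁ (x, y) with hV₀
  set β : ℝ := ‖V₀‖ with hβ
  have hβ0 : β ≠ 0 := norm_ne_zero_iff.2 hV
  set U : F := fderiv ℝ (linkField N r₁) (x, y) (0, w) with hU
  set e : ℝ := η t with he
  set e' : ℝ := deriv η t with he'
  -- (1) derivative along the line equals `Dφ (0, w)`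
  have hd : DifferentiableAt ℝ (roundMap N r₁ ρ η) (x, y) :=
    (contDiffAt_roundMap (p := (x, y)) hp hN hV hη).differentiableAt round_infty_ne_zero
  have hl : HasDerivAt (fun τ : ℝ => y + τ • w) w 0 := round_hasDerivAt_line y w 0
  have hline : HasDerivAt (fun τ : ℝ => (((x, y + τ • w)) : E × F)) (((0 : E), w) : E × F) 0 :=
    (hasDerivAt_const (0 : ℝ) x).prodMk hl
  have h1 : HasDerivAt (fun τ : ℝ => roundMap N r₁ ρ η (x, y + τ • w))
      (fderiv ℝ (roundMap N r₁ ρ η) (x, y) (0, w)) 0 :=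
    hd.hasFDerivAt.comp_hasDerivAt_of_eq (0 : ℝ) hline (by simp)
  -- (2) the pieces: `t(τ)`, `η(t(τ))`, `V(τ)`, `β(τ) = ‖V(τ)‖`, the coefficient `c(τ)`
  have hnorm : HasDerivAt (fun τ : ℝ => ‖y + τ • w‖) a 0 := round_hasDerivAt_norm_line hp
  have hv0 : ‖y + (0 : ℝ) • w‖ = t := by rw [zero_smul, add_zero]
  have hηd : HasDerivAt η e' t := (hη.differentiableAt round_infty_ne_zero).hasDerivAt
  have hητ : HasDerivAt (fun τ : ℝ => η ‖y + τ • w‖) (e' * a) 0 :=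
    hηd.comp_of_eq 0 hnorm (by rw [zero_smul, add_zero])
  have hVd : DifferentiableAt ℝ (linkField N r₁) (x, y) :=
    (contDiffAt_linkField (p := (x, y)) hp hN).differentiableAt round_infty_ne_zero
  have hVτ : HasDerivAt (fun τ : ℝ => linkField N r₁ (x, y + τ • w)) U 0 :=
    hVd.hasFDerivAt.comp_hasDerivAt_of_eq (0 : ℝ) hline (by simp)
  have hVv0 : linkField N r₁ (x, y + (0 : ℝ) • w) = V₀ := by rw [zero_smul, add_zero]
  have hβτ : HasDerivAt (fun τ : ℝ => ‖linkField N r₁ (x, y + τ • w)‖) ⟪β⁻¹ • V₀, U⟫ 0 := by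
    have := round_hasDerivAt_norm_comp hVτ (by rw [hVv0]; exact hV)
    rw [hVv0] at this
    exact this
  -- the coefficient `c(τ) = (1 - η) ρ / β + η`
  have hc : HasDerivAt (fun τ : ℝ =>
      (1 - η ‖y + τ • w‖) * ρ / ‖linkField N r₁ (x, y + τ • w)‖ + η ‖y + τ • w‖)
      (((-(e' * a) * ρ) * β - (1 - e) * ρ * ⟪β⁻¹ • V₀, U⟫) / β ^ 2 + e' * a) 0 := by
    have hnum : HasDerivAt (fun τ : ℝ => (1 - η ‖y + τ • w‖) * ρ) (-(e' * a) * ρ) 0 :=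
      (HasDerivAt.const_sub 1 hητ).mul_const ρ
    have hq := hnum.fun_div hβτ (by rw [hVv0]; exact hβ0)
    rw [hv0, hVv0] at hq
    exact hq.fun_add hητ
  -- the scalar factor `t(τ) c(τ)` and the product with `V(τ)`
  have hsc : HasDerivAt (fun τ : ℝ => ‖y + τ • w‖ *
      ((1 - η ‖y + τ • w‖) * ρ / ‖linkField N r₁ (x, y + τ • w)‖ + η ‖y + τ • w‖))
      (a * ((1 - e) * ρ / β + e) +
        t * (((-(e' * a) * ρ) * β - (1 - e) * ρ * ⟪β⁻¹ • V₀, U⟫) / β ^ 2 + e' * a)) 0 := by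
    have := hnorm.fun_mul hc
    rw [hv0, hVv0] at this
    exact this
  have h2 : HasDerivAt (fun τ : ℝ => roundMap N r₁ ρ η (x, y + τ • w))
      ((a * ((1 - e) * ρ / β + e) +
          t * (((-(e' * a) * ρ) * β - (1 - e) * ρ * ⟪β⁻¹ • V₀, U⟫) / β ^ 2 + e' * a)) • V₀ +
        (t * ((1 - e) * ρ / β + e)) • U) 0 := by
    have := hsc.fun_smul hVτ
    rw [hv0, hVv0, add_comm] at this
    exact this
  rw [h1.unique h2]
  -- (3) the two scalar coefficients agree
  congr 1
  congr 1
  congr 1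
  field_simp
  ring

/-- **Radial transversality kills angular kernel vectors** (copy of the argument of
`TubeLink.eq_zero_of_fderiv_mem_span_of_transversal`, for the fibre derivative of
`N : E × F → F`): if `u ⊥ z`, `DN(q)(0,u) = c • N q`, the fibre derivative is injective and
`DN(q)(0,v) = N q ⟹ ⟪v, z⟫ > 0`, then `u = 0`. [folklore] -/
theorem eq_zero_of_fderiv_fibre_mem_span {q : E × F} {z : F}
    (hinj : ∀ u : F, fderiv ℝ N q (0, u) = 0 → u = 0)
    (htr : ∀ v : F, fderiv ℝ N q (0, v) = N q → 0 < ⟪v, z⟫) {u : F} (hu : ⟪u, z⟫ = 0)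
    (hspan : ∃ c : ℝ, fderiv ℝ N q (0, u) = c • N q) : u = 0 := by
  obtain ⟨c, hc⟩ := hspan
  by_cases hc0 : c = 0
  · rw [hc0, zero_smul] at hc
    exact hinj u hc
  · have h1 : fderiv ℝ N q (0, c⁻¹ • u) = N q := by
      have : (((0 : E), c⁻¹ • u) : E × F) = c⁻¹ • ((0 : E), u) := by ext <;> simp
      rw [this, map_smul, hc, smul_smul, inv_mul_cancel₀ hc0, one_smul]
    have h2 := htr _ h1
    rw [real_inner_smul_left, hu, mul_zero] at h2
    exact absurd h2 (lt_irrefl 0)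

/-- **Nondegeneracy of rounding** (pointwise criterion). Let `y ≠ 0`, `r₁ > 0`, `N` smooth at
the link point `q₁ = (x, r₁ ŷ)` with `V = linkField N r₁ p ≠ 0`, `η` smooth at `t = ‖y‖` with
**monotone profile** `η'(t) ≥ 0` and `η t ∈ [0, 1]`, radius **`0 < ρ ≤ ‖V‖`**, and assume the
link of `N` at radius `r₁` is **radially transversal** at `q₁`: the fibre derivative
`u ↦ DN(q₁)(0,u)` is injective and `DN(q₁)(0,v) = N q₁ ⟹ ⟪v, ŷ⟫ > 0`.  Then the derivative of
the rounded stage map at `p` is injective.  Proof: a kernel vector `(0, w)` gives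
`(a c₀ + t c₁) • V + (t c₀) • U = 0`, `U = t⁻¹ DN(q₁)(0, u)`, `u = w − aŷ ⊥ ŷ`; so `DN(q₁)(0,u)` is a
multiple of `V`, hence of `N q₁`, and `u = 0` by transversality; then `U = 0`, `c₁ = η' a (1 − ρ/β)`
and `a (c₀ + t η'(1 − ρ/β)) = 0` with `c₀ > 0`, `t η' (1 − ρ/β) ≥ 0`, so `a = 0` and `w = 0`.
Campbell–D'Onofrio–Vítek (2026), Lemma 3.4 Step 2. [cite: CampbellDonofrioVitek2026, Lemma 3.4 (Step 2)] -/
theorem injective_fderiv_roundStageMap (hp : p.2 ≠ 0) (hr : 0 < r₁)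
    (hN : ContDiffAt ℝ ∞ N (linkPoint r₁ p)) (hV : linkField N r₁ p ≠ 0)
    (hη : ContDiffAt ℝ ∞ η ‖p.2‖) (hη01 : η ‖p.2‖ ∈ Icc (0 : ℝ) 1) (hη' : 0 ≤ deriv η ‖p.2‖)
    (hρ : 0 < ρ) (hρV : ρ ≤ ‖linkField N r₁ p‖)
    (hinj : ∀ u : F, fderiv ℝ N (linkPoint r₁ p) (0, u) = 0 → u = 0)
    (htr : ∀ v : F, fderiv ℝ N (linkPoint r₁ p) (0, v) = N (linkPoint r₁ p) →
      0 < ⟪v, ‖p.2‖⁻¹ • p.2⟫) :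
    Injective (fderiv ℝ (roundStageMap N r₁ ρ η) p) := by
  have hd : DifferentiableAt ℝ (roundMap N r₁ ρ η) p :=
    (contDiffAt_roundMap hp hN hV hη).differentiableAt round_infty_ne_zero
  have hΦ : HasFDerivAt (roundStageMap N r₁ ρ η)
      ((ContinuousLinearMap.fst ℝ E F).prod (fderiv ℝ (roundMap N r₁ ρ η) p)) p :=
    hasFDerivAt_fst.prodMk hd.hasFDerivAt
  rw [hΦ.fderiv]
  refine (injective_iff_map_eq_zero _).2 fun vw h => ?_
  obtain ⟨v, w⟩ := vw
  have h1 := congrArg Prod.fst h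
  have h2 := congrArg Prod.snd h
  simp only [ContinuousLinearMap.prod_apply, ContinuousLinearMap.coe_fst', Prod.fst_zero] at h1
  subst h1
  simp only [ContinuousLinearMap.prod_apply, Prod.snd_zero] at h2
  -- notation
  set t : ℝ := ‖p.2‖ with ht
  have ht0 : 0 < t := norm_pos_iff.2 hp
  set a : ℝ := ⟪‖p.2‖⁻¹ • p.2, w⟫ with ha
  set V₀ : F := linkField N r₁ p with hV₀
  set β : ℝ := ‖V₀‖ with hβ
  have hβ0 : 0 < β := norm_pos_iff.2 hV
  set U : F := fderiv ℝ (linkField N r₁) p (0, w) with hU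
  set q := linkPoint r₁ p with hq
  set u : F := w - a • (‖p.2‖⁻¹ • p.2) with hu
  set c₀ : ℝ := (1 - η t) * ρ / β + η t with hc₀
  have hc₀pos : 0 < c₀ := by
    have h1 : 0 ≤ (1 - η t) * ρ / β := div_nonneg (mul_nonneg (by linarith [hη01.2]) hρ.le) hβ0.le
    have h2 : 0 ≤ η t := hη01.1
    -- at least one of the two terms is positive
    rcases eq_or_lt_of_le h2 with h0 | hpos
    · have : (1 - η t) * ρ / β = ρ / β := by rw [← h0]; ring
      rw [hc₀, this, ← h0, add_zero]
      exact div_pos hρ hβ0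
    · rw [hc₀]; linarith
  -- the derivative formula
  have hU' : U = t⁻¹ • fderiv ℝ N q (0, u) := fderiv_linkField_apply_inr hp hr.ne' hN w
  rw [fderiv_roundMap_apply_inr hp hN hV hη w] at h2
  rw [← hU, ← hV₀, ← ha, ← ht] at h2
  -- `h2 : (a c₀ + t c₁) • V₀ + (t c₀) • U = 0`
  -- Step 1: `DN(q)(0,u)` lies in the line of `N q`, hence `u = 0`
  have hu_perp : ⟪u, ‖p.2‖⁻¹ • p.2⟫ = 0 := by
    have hunit : ⟪‖p.2‖⁻¹ • p.2, ‖p.2‖⁻¹ • p.2⟫ = 1 := by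
      rw [real_inner_smul_left, real_inner_smul_right, real_inner_self_eq_norm_sq]
      field_simp
    rw [hu, inner_sub_left, real_inner_smul_left, hunit, mul_one, real_inner_comm, ← ha, sub_self]
  have hspan : ∃ c : ℝ, fderiv ℝ N q (0, u) = c • N q := by
    -- solve `h2` for `U`: `(t c₀) • U = -(a c₀ + t c₁) • V₀`, and `V₀ = r₁⁻¹ • N q`
    set s : ℝ := a * ((1 - η t) * ρ / β + η t) +
      t * (deriv η t * a * (1 - ρ / β) - (1 - η t) * ρ * ⟪β⁻¹ • V₀, U⟫ / β ^ 2) with hs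
    have h3 : (t * c₀) • U = (-s) • V₀ := by
      have := h2
      rw [add_comm, add_eq_zero_iff_eq_neg, ← neg_smul] at this
      exact this
    have htc : t * c₀ ≠ 0 := mul_ne_zero ht0.ne' hc₀pos.ne'
    refine ⟨r₁⁻¹ * ((t * c₀)⁻¹ * (-s)) * t, ?_⟩
    have h4 : U = ((t * c₀)⁻¹ * (-s)) • V₀ := by
      rw [← smul_smul, ← h3, smul_smul, inv_mul_cancel₀ htc, one_smul]
    have h5 : fderiv ℝ N q (0, u) = t • U := by
      rw [hU', smul_smul, mul_inv_cancel₀ ht0.ne', one_smul]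
    rw [h5, h4, hV₀, linkField_eq, smul_smul, smul_smul]
    congr 1
    ring
  have hu0 : u = 0 := eq_zero_of_fderiv_fibre_mem_span hinj htr hu_perp hspan
  -- Step 2: with `u = 0`, `U = 0` and the radial equation forces `a = 0`
  have hU0 : U = 0 := by
    rw [hU', hu0]
    have : (((0 : E), (0 : F)) : E × F) = 0 := rfl
    rw [this, map_zero, smul_zero]
  rw [hU0, smul_zero, add_zero, inner_zero_right, mul_zero, zero_div, sub_zero] at h2
  -- `h2 : (a c₀ + t (η' a (1 - ρ/β))) • V₀ = 0`
  have hcoef : a * ((1 - η t) * ρ / β + η t) + t * (deriv η t * a * (1 - ρ / β)) = 0 := by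
    rcases smul_eq_zero.1 h2 with h | h
    · exact h
    · exact absurd h hV
  have hbr : 0 < ((1 - η t) * ρ / β + η t) + t * (deriv η t * (1 - ρ / β)) := by
    have h1 : 0 ≤ 1 - ρ / β := by
      rw [sub_nonneg, div_le_one hβ0]; exact hρV
    have h2 : 0 ≤ t * (deriv η t * (1 - ρ / β)) := mul_nonneg ht0.le (mul_nonneg hη' h1)
    linarith
  have ha0 : a = 0 := by
    have : a * (((1 - η t) * ρ / β + η t) + t * (deriv η t * (1 - ρ / β))) = 0 := by
      rw [← hcoef]; ring
    exact (mul_eq_zero.1 this).resolve_right hbr.ne'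
  have hw : w = 0 := by
    have : w = u + a • (‖p.2‖⁻¹ • p.2) := by rw [hu, sub_add_cancel]
    rw [this, hu0, ha0, zero_smul, add_zero]
  rw [hw]
  rfl

/-- Packaged form for the inverse function theorem (finite-dimensional `E`, `F`). [folklore] -/
theorem exists_hasFDerivAt_equiv_roundStageMap [FiniteDimensional ℝ E] [FiniteDimensional ℝ F]
    (hp : p.2 ≠ 0) (hr : 0 < r₁) (hN : ContDiffAt ℝ ∞ N (linkPoint r₁ p))
    (hV : linkField N r₁ p ≠ 0) (hη : ContDiffAt ℝ ∞ η ‖p.2‖) (hη01 : η ‖p.2‖ ∈ Icc (0 : ℝ) 1)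
    (hη' : 0 ≤ deriv η ‖p.2‖) (hρ : 0 < ρ) (hρV : ρ ≤ ‖linkField N r₁ p‖)
    (hinj : ∀ u : F, fderiv ℝ N (linkPoint r₁ p) (0, u) = 0 → u = 0)
    (htr : ∀ v : F, fderiv ℝ N (linkPoint r₁ p) (0, v) = N (linkPoint r₁ p) →
      0 < ⟪v, ‖p.2‖⁻¹ • p.2⟫) :
    ∃ L : (E × F) ≃L[ℝ] E × F,
      HasFDerivAt (roundStageMap N r₁ ρ η) (L : E × F →L[ℝ] E × F) p := by
  have hd : DifferentiableAt ℝ (roundStageMap N r₁ ρ η) p :=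
    (contDiffAt_roundStageMap hp hN hV hη).differentiableAt round_infty_ne_zero
  have hinj' := injective_fderiv_roundStageMap hp hr hN hV hη hη01 hη' hρ hρV hinj htr
  let L : (E × F) ≃L[ℝ] E × F :=
    LinearEquiv.toContinuousLinearEquiv
      (LinearEquiv.ofInjectiveEndo (fderiv ℝ (roundStageMap N r₁ ρ η) p).toLinearMap hinj')
  refine ⟨L, ?_⟩
  have hcoe : (L : E × F →L[ℝ] E × F) = fderiv ℝ (roundStageMap N r₁ ρ η) p :=
    ContinuousLinearMap.ext fun v => rfl
  rw [hcoe]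
  exact hd.hasFDerivAt

end Round

end Literature.Topology.FourManifolds
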